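import Mathlib

/-!
# Abstract quaternion field switch · eigenline of `⋀ᵖT` for a two-eigenvalue operator

Helper file for the stub `stub_abstractSwitch` (line `Sketch`, idea `dicyclic-quaternion-switch`,
crux `HeckePrymWeil.HyperbolicEightfoldsSqrtMinus7`, item stmt-HodgeConjecture-14642).

* `eigenspace_le_span_of_diag` : an operator diagonal in a basis `B` with eigenvalues `δ` has
  `Eig(D, μ) ≤ span {B i | δ i = μ}`.
* `extPow_eigenspace_le_line` : if `T` acts on a basis `b` of `V` indexed by `Fin (p + p)` by `d₁`
  on the first half and by `d₂` on the second half, and `d₁^j d₂^(p-j) = μ` forces `j = p`, then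
  the `μ`-eigenspace of `⋀ᵖT` on `⋀ᵖV` is contained in the LINE spanned by the wedge of the first
  half of the basis (the exterior-power basis `b.exteriorPower p` diagonalises `⋀ᵖT` with
  eigenvalue `∏_{i ∈ s} d i` on the basis vector indexed by `s`).
-/

-- `Summit.HodgeConjecture.HodgeConjecture.…` is the tree's mandated namespace (summit = problem name).
set_option linter.dupNamespace false

namespace Summit.HodgeConjecture.HodgeConjecture.Theorems.HyperbolicEightfoldsSqrtMinus7.DicyclicQuaternionSwitch

open Finset Module

/-- **Eigenspaces of a diagonal operator.**  If `D (B i) = δ i • B i` for a basis `B`, then the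
`μ`-eigenspace of `D` is contained in (in fact equals) the span of the `B i` with `δ i = μ`.
[folklore] -/
theorem eigenspace_le_span_of_diag {ι K V : Type*} [Field K] [AddCommGroup V] [Module K V]
    (B : Basis ι K V) (D : V →ₗ[K] V) (δ : ι → K) (hD : ∀ i, D (B i) = δ i • B i) (μ : K) :
    Module.End.eigenspace D μ ≤ Submodule.span K (B '' {i | δ i = μ}) := by
  classical
  intro x hx
  rw [Module.End.mem_eigenspace_iff] at hx
  rw [Basis.mem_span_image]
  intro i hi
  rw [Finset.mem_coe, Finsupp.mem_support_iff] at hi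
  by_contra hne
  apply hi
  have h1 : B.repr (D x) i = δ i * B.repr x i := by
    have key : (B.coord i) ∘ₗ D = δ i • B.coord i := by
      refine B.ext (fun j => ?_)
      by_cases hij : j = i
      · subst hij
        simp [hD]
      · simp [hD, hij]
    simpa using LinearMap.congr_fun key x
  have h2 : B.repr (D x) i = μ * B.repr x i := by
    rw [hx]
    simp
  have h3 : (δ i - μ) * B.repr x i = 0 := by rw [sub_mul, ← h1, ← h2, sub_self]
  rcases mul_eq_zero.1 h3 with h | h
  · exact absurd (sub_eq_zero.1 h) hne
  · exact h

/-- **The `μ`-eigenline of `⋀ᵖT`.**  Let `b` be a basis of `V` indexed by `Fin (p + p)` and `T` an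
endomorphism acting by the scalar `d₁` on the first `p` basis vectors and by `d₂` on the last `p`.
If `d₁^j · d₂^(p-j) = μ` (with `j ≤ p`) forces `j = p`, then the `μ`-eigenspace of `⋀ᵖT` is contained
in the line spanned by `b 0 ∧ ⋯ ∧ b (p-1)`, the wedge of the first half of the basis.  (The exterior
power basis diagonalises `⋀ᵖT`; the basis vector indexed by the `p`-set `s` has eigenvalue
`d₁^{#(s ∩ first half)} d₂^{#(s ∩ second half)}`.) [folklore] -/
theorem extPow_eigenspace_le_line :
    ∀ {K V : Type} [Field K] [AddCommGroup V] [Module K V] {p : ℕ}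
      (b : Module.Basis (Fin (p + p)) K V) (T : V →ₗ[K] V) (d₁ d₂ μ : K),
      (∀ i : Fin p, T (b (Fin.castAdd p i)) = d₁ • b (Fin.castAdd p i)) →
      (∀ i : Fin p, T (b (Fin.natAdd p i)) = d₂ • b (Fin.natAdd p i)) →
      (∀ j ≤ p, d₁ ^ j * d₂ ^ (p - j) = μ → j = p) →
    Module.End.eigenspace (exteriorPower.map p T) μ ≤
      K ∙ exteriorPower.ιMulti K p (fun i => b (Fin.castAdd p i)) := by
  intro K V _ _ _ p b T d₁ d₂ μ h₁ h₂ hsep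
  classical
  -- the eigenvalue of `T` on `b i`
  set d : Fin (p + p) → K := fun i => if (i : ℕ) < p then d₁ else d₂ with hd
  have hT : ∀ i, T (b i) = d i • b i := by
    intro i
    induction i using Fin.addCases with
    | left i =>
      have hi : ((Fin.castAdd p i : Fin (p + p)) : ℕ) < p := by simp
      rw [h₁, hd]
      dsimp only
      rw [if_pos hi]
    | right i =>
      have hi : ¬ ((Fin.natAdd p i : Fin (p + p)) : ℕ) < p := by simp
      rw [h₂, hd]
      dsimp only
      rw [if_neg hi]
  -- `⋀ᵖT` is diagonal in the exterior-power basis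
  set B := b.exteriorPower p with hB
  set δ : Set.powersetCard (Fin (p + p)) p → K := fun s => ∏ i ∈ (s : Finset (Fin (p + p))), d i
    with hδ
  have hD : ∀ s, exteriorPower.map p T (B s) = δ s • B s := by
    intro s
    rw [hB, exteriorPower.basis_apply, exteriorPower.map_apply_ιMulti_family]
    unfold exteriorPower.ιMulti_family
    have hfun : ((⇑T ∘ ⇑b) ∘ ⇑(Set.powersetCard.ofFinEmbEquiv.symm s)) =
        fun i => d (Set.powersetCard.ofFinEmbEquiv.symm s i) •
          (⇑b ∘ ⇑(Set.powersetCard.ofFinEmbEquiv.symm s)) i := by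
      ext i
      simp [hT]
    rw [hfun, AlternatingMap.map_smul_univ]
    congr 1
    rw [hδ]
    dsimp only
    symm
    conv_lhs => rw [← Finset.map_orderEmbOfFin_univ (s : Finset (Fin (p + p))) s.prop]
    rw [Finset.prod_map]
    rfl
  -- the first half, as a `p`-set
  set s₀ : Set.powersetCard (Fin (p + p)) p :=
    ⟨(univ : Finset (Fin p)).map (Fin.castAddOrderEmb p).toEmbedding, by
      rw [Set.powersetCard.mem_iff, card_map, card_univ, Fintype.card_fin]⟩ with hs₀
  have hmem₀ : ∀ i : Fin (p + p), i ∈ (s₀ : Finset (Fin (p + p))) ↔ (i : ℕ) < p := by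
    intro i
    simp only [hs₀, mem_map, mem_univ, true_and, RelEmbedding.coe_toEmbedding,
      Fin.castAddOrderEmb_apply]
    constructor
    · rintro ⟨j, rfl⟩
      simp
    · intro hi
      exact ⟨⟨i, hi⟩, Fin.ext (by simp)⟩
  -- only `s₀` has eigenvalue `μ`
  have honly : ∀ s : Set.powersetCard (Fin (p + p)) p, δ s = μ → s = s₀ := by
    intro s hs
    have hsplit : δ s = d₁ ^ ((s : Finset (Fin (p + p))).filter (fun i : Fin (p + p) => (i : ℕ) < p)).card *
        d₂ ^ ((s : Finset (Fin (p + p))).filter (fun i : Fin (p + p) => ¬ (i : ℕ) < p)).card := by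
      rw [hδ]
      dsimp only
      rw [hd, prod_ite, prod_const, prod_const]
    have hcard := Finset.card_filter_add_card_filter_not (s := (s : Finset (Fin (p + p))))
      (fun i : Fin (p + p) => (i : ℕ) < p)
    rw [Set.powersetCard.card_eq] at hcard
    have hj : ((s : Finset (Fin (p + p))).filter (fun i : Fin (p + p) => (i : ℕ) < p)).card = p := by
      refine hsep _ (by omega) ?_
      rw [← hs, hsplit]
      congr 2
      omega
    have hempty : ((s : Finset (Fin (p + p))).filter (fun i : Fin (p + p) => ¬ (i : ℕ) < p)) = ∅ := by
      rw [← Finset.card_eq_zero]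
      omega
    rw [Set.powersetCard.eq_iff_subset]
    intro i hi
    rw [hmem₀]
    by_contra hip
    rw [Finset.filter_eq_empty_iff] at hempty
    exact hempty hi hip
  -- the basis vector indexed by `s₀` is the wedge of the first half
  have hB₀ : B s₀ = exteriorPower.ιMulti K p (fun i => b (Fin.castAdd p i)) := by
    rw [hB, exteriorPower.basis_apply]
    unfold exteriorPower.ιMulti_family
    congr 1
    ext i
    simp only [Function.comp_apply, Set.powersetCard.ofFinEmbEquiv_symm_apply]
    congr 1
    have huniq : (Fin.castAddOrderEmb p : Fin p ↪o Fin (p + p)) =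
        (s₀ : Finset (Fin (p + p))).orderEmbOfFin s₀.prop :=
      Finset.orderEmbOfFin_unique' _ (fun j => (hmem₀ _).2 (by simp))
    rw [← huniq, Fin.castAddOrderEmb_apply]
  -- conclusion
  refine (eigenspace_le_span_of_diag B _ δ hD μ).trans (Submodule.span_mono ?_)
  rintro _ ⟨s, hs, rfl⟩
  rw [Set.mem_singleton_iff, honly s hs, hB₀]

end Summit.HodgeConjecture.HodgeConjecture.Theorems.HyperbolicEightfoldsSqrtMinus7.DicyclicQuaternionSwitch
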